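import Summits.BirchSwinnertonDyer.Rank1Residual.Supersingular.KobayashiMainConjectureX6BSTWScope
import HarnessLib

/-!
# The `p = 3` TIER of the cell's reading of Burungale–Skinner–Tian–Wan Thm. 1.3 as a typed OPEN binder:
# semistable `E`, good supersingular `3` with `a₃ = 0`, the auxiliary (ram) prime / imaginary quadratic
# field of the printed proof with `3 ∤ h_L` — and its class-X6 consumers (cell `bsd-ssimc`, seat
# `bsd-ssimc-k3-c2` gen 2; planner ORDERS v11 row k3-c2 (b) / fragment D0074-bsd-ssimc-seats.md row 1;
# route `SignedLowerHalves` item 2 = stmt-BirchSwinnertonDyer-19000, registered stub `stub_three`)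

HONEST FRAMING (verbatim spirit of the cell README §4): nothing here is a theorem about any curve; an
ANNOUNCED preprint (BSTW, arXiv:2409.01350v2) enters ONLY as an explicitly labelled OPEN binder
(`…_OPEN : Prop`, `[claim: …, under-review]`, NEVER a theorem); published results are consumed BY NAME;
BSD is not proved by any of this; the crux `KobayashiLowerHalfSemistable` stays OPEN on the ledger.
PARTITION (D-0054): X6 ∧ r = 0 (A6) × the 12 cells at `p = 3` (`a₃ = 0`) — types-the-object-of; closes none.

## Why this file

The companion file `KobayashiMainConjectureX6BSTWScope.lean` (gen 0) types the cell's verified reading of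
BSTW Thm. 1.3 at `p ≥ 5` as ONE named `Prop`, `BurungaleSkinnerTianWan2024_thm13_scoped_OPEN`: `5 ≤ p`,
`Semistable W`, `GoodSS W p` and a scope witness `BSTWScope.HasWitness W p` (S1: a (ram) prime `q`; S2 + G3:
an auxiliary imaginary quadratic `L` — `p` split, `q` inert, the primes of `N/q` split, `(d_L, 2N) = 1`,
`2` split if `2 ∤ N`; (α): `p ∤ h_L`) ⟹ Kobayashi's main conjecture for both signs. It EXCLUDES `p = 3`
by design, because the cell's verification of record is a different object there (TARGET.md v10–v12 line 2,
RELAY-6): REPORT-bstw-7 (referee, sha16 40fdbe7e627732c4, PASS on bstw-MEMO-7 1fa682b12be3a3f9) — at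
`p = 3` (class X6: `a₃ = 0`, semistable, `3 ∤ N`) BSTW's OWN clause (Rem. 5.1, §3.2.3) rests on the
PREPRINT [SV-S-Ohta]; the cell's p = 3 programme localises the p ≥ 5 chain at 3 modulo the bookkeeping
items M1–M3 (refereed-print replacements, «bookkeeping, unwritten») and ONE located residual WITHOUT
refereed print: **(3-ii)♭ = Ohta's Λ-adic Eichler–Shimura isomorphism for the FULL (Eisenstein-inclusive,
open-curve) `e′H¹(Y₁(N·3^∞))` at `p = 3`** — mathematics, not bookkeeping (referee CONCURRED). So the
12 A6 cells at `p = 3` are «NOT bookable on cell verification» (flag `BSTW13-p3-OhtaES-preprint`).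

This file gives that p = 3 reading ITS OWN NAME, `BurungaleSkinnerTianWan2024_thm13_scopedAtThree_OPEN`
— the exact twin of the `p ≥ 5` binder with `5 ≤ p` replaced by `p = 3 ∧ a₃ = 0` — so that (i) the
registered stub `stub_three` of crux 2 and the 12 A6 @ 3 cells read MODULO ONE NAMED `Prop` whose
docstring carries the located residual, distinct from the `p ≥ 5` tier the operator may book differently;
(ii) the scope datum at `p = 3` (S1/S2/(α) with `3 ∤ h_L`, a much stronger class-number condition than at
`p ≥ 5`) becomes a kernel-checkable per-class hypothesis through the SAME `BSTWScope.hasWitness_of_kronecker`;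
(iii) the crux BY NAME reads modulo the two scoped binders and the class-wide witness hypothesis alone
(`Theorems/SignedLowerHalvesKobayashiLowerHalfSemistableScopeThree.lean`). The auxiliary choices S1/S2 of
BSTW Part II §2.3 are prime-independent text (p0076 of the held text `paper:arxiv-2409.01350`: "there exists
a prime `q | N` satisfying the condition (ram) … Pick an imaginary quadratic field `L` such that (ord) holds
and `(D_L, 2N) = 1` …"), so `BSTWScope.IsAuxiliaryPrime` / `IsAuxiliaryField` / `HasWitness` are reused
verbatim at `p = 3`.

## Contents

* `BurungaleSkinnerTianWan2024_thm13_scopedAtThree_OPEN` — the OPEN binder: `p = 3`, `Semistable W`,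
  `GoodSS W p`, `a₃ = 0`, `BSTWScope.HasWitness W p` ⟹ `KobayashiMainConjecture W p ε` for every sign.
  NEVER a theorem.
* `thm13_scopedAtThree_OPEN_of_thm13_OPEN` — implied by the printed binder (sanity: weaker claim).
* Consumers on class X6 at `p = 3` with a witness: the main conjecture, its Eisenstein half
  (`KobayashiLowerDivisibility`, the crux's predicate), `BSD(E,3)` in analytic rank 0 (± road, PUB inputs by
  name; all 12 A6 @ 3 cells are rank 0).

What this file is NOT: not a typing of (3-ii)♭ itself (the tree has no Λ-adic ordinary-cohomology
vocabulary for `e′H¹(Y₁(Np^∞))`; that is a typer object, ORDERS v11 bstw (3) / MEMO-8); not a claim that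
BSTW Thm. 1.3 holds at 3; not a booking.

## Litref D-audit of record (cell `pub/bsd-litref`, tranche T2b, 2026-08-26) — printed numbering, located lines

Reading of record: `pub/bsd-litref/bstw24/sheets/D-AUDIT-bstw24-r1.md` sha16 2ab68891cb7b08bc (reader 1, FROZEN) +
ADDENDA 1–5 dd57a5d99fb5bd7f / 5fc2aa1cce88a1ac / f18da4daf35aa2e0 / 14b633e2f406b0ef / 73386cd869069474 (O3 / O5 at p =
3 UNCHANGED by all five; ADDENDUM-5 = Q1 / Prop. 4.12 only: wording lacuna conceded, inference repaired — see
`KobayashiMainConjectureX6BSTWScopeS.lean`; ADDENDUM-4 = reader 1's row-specific prong engagement statements per R361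
(ε), the (anom) branch of §5 on row A10, Q-r08-1, freshness 23:05Z); numbering map TYPER-SHEET-bstw24-v1.md
97f02770e335ef56 / LABELS-bstw24-v2.tsv 968d2043eb365520. PRINTED NUMBERING (arXiv v2 PDF, 103 pp.; the cell memos
quoted in this file use the held extraction's numbering — one section low in Part I, restarted in Part II): «Rem. 5.1» =
printed Rem. 6.1 (p. 58; TeX l.4918–4922 of the v2 source, sha16 5926f035551c636d); «§3.2.3» = printed §4.2.3 «The
Λ_D-adic Tate modules: generalities» (p. 34: Thm. 4.1 `ordTate` + its note l.2915, Thm. 4.2 `ordTate-dual`); «Part II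
§2.3 / Thm. 2.1 / Thm. 2.5 / Thm. 1.24 / Prop. 1.18» = printed §10.3 (p. 88) / Thm. 10.1 (p. 86) / Thm. 10.5 (p. 87) /
Thm. 9.24 (p. 85) / Prop. 9.18 (p. 83); (h4) = (1.7) (p. 6); (KoMC_r) = Thm. 10.1. THE p = 3 RESIDUAL AS LOCATED BY THE
LITREF READING (verdict O5, with O3; GAP(line); reached independently of and CONCURRING with REPORT-bstw-7's (3-ii)♭):
the dependence on the unpublished [SV-S-Ohta] (= Sangiovanni Vincentelli–Skinner, «preprint», bib l.8699; publicly
unlocated 2026-08-26 — r1 §6 repair census: arXiv / zbMATH / Crossref / galaxy 0 hits; Cais 2018 covers the CLOSED curve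
`X₁` only, p > 2, Np > 4) enters at TWO printed places: (i) the note after Thm. 4.1 (TeX l.2915, p. 34): «For p ≥ 5,
this theorem is explained in [FK, §§1.7–1.8]. It is also proved in [Oh1, Oh2] … See also [KLZ, Thm. 7.2.3]. The
arguments in these papers likely apply to the p = 3 case as well. The results of [Ca] explicitly covers some parts of
the p = 3 cases. An alternate proof that also includes the p = 3 case is included in [SV-S-Ohta].» — Thm. 4.1 (i)(ii)
(Λ-adic Eichler–Shimura for `H¹_ord` AND `𝓗¹_ord` of the tower `Y₁(D_L p^∞)`) with Thm. 4.2 (twisted Poincaré duality)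
carries the whole §4 lattice analysis (Lem. 4.4–4.8, Props. 4.9–4.13, 4.17, Lem. 4.18, Thms. 4.20 / 4.22) and (Ind) =
Thms. 5.19 / 5.20; (ii) Rem. 6.1 (TeX l.4918–4922, p. 58): «In [LLZa], [KLZ], [LZ], [BL] it is assumed that p > 3 … the
pertinent Eichler–Shimura isomorphism is proved in [SV-S-Ohta] (with many cases already covered in Cais [Ca]) for p ≥ 3,
and so the explicit reciprocity laws hold in our setting for any odd prime p.» — the ± Beilinson–Flach classes and
reciprocity laws of §6 (Thm. 6.2, Lem. 6.3, Thms. 6.8 / 6.15, ERLs 6.4 / 6.10 / 6.16 / 6.17) that feed Prop. 9.18 / Thm.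
10.5. Fine at p = 3 on class X6 (r1 O5): Ribet's theorem for the (ram) prime (l.7457, printed «level raising»; the
level-lowering argument) and Kato's divisibility in the Thm. 13.4 (3) shape. STRIKE CONDITION (r1 §5; = (3-ii)♭ above):
a refereed — or public and cell-refereed — proof of the Λ-adic Eichler–Shimura theorem for `e·H¹_ét` of the OPEN tower
`Y₁(D_L·3^∞)` localised at the Eisenstein maximal ideal of `𝐡_v` (Thm. 4.1 (i)(ii) + Thm. 4.2) together with [KLZ] Thms.
7.2.3 / 8.2.3 / 10.2.2 at p = 3, i.e. publication of [SV-S-Ohta] or an equivalent. PRONG MAP of record for the common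
Ohta-ES@3 node (referee C ROUND 361, 2026-08-26T21:22:43Z, sharpening R353 (ζ)): «supersingular rows (D2@3 = RELAY-6;
the jsw17/(3-ii)♭ context of R353) engage G♭ only (the g-side is a Coleman family via [LZ]/[AIS15] …)», with «G♭ (= r1's
G2): the same package for the CM family 𝐡_v at (3, ω^{−1}), OPEN-CURVE row at its Eisenstein ideal — [SV-S-Ohta] PRE»
and strike test «(ii) for G♭ the open curve Y₁(D_K·3^∞) at the Eisenstein ideal of 𝐡_v» — THIS supersingular tier
engages G♭ ONLY (reader 1 ADDENDUM-4 §A.2, first-hand at the g-side inputs' standing lines: the g-side of §6 is a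
COLEMAN family (l.4896, l.4910–4915), [LZ16] «Let p > 2 be a prime» [corpus:paper:arxiv-1506.06703-gx92048600
p0001:L25], [AIS15] «Let p ≥ 3 be a prime integer» with p = 3 treated explicitly («w < 1/3^r if p = 3»)
[corpus:paper:arxiv-1303.4878 p0005:L5, p0019:L21] ⇒ no Ohta-type prong on the g-side at 3; [BL]'s own «Fix forever a
prime p ≥ 5 …» standing [corpus:paper:arxiv-1605.05310 p0003:L3] recorded as an input-level rider, its internals not
verified — all three loci re-read by the typer; CONCUR with R361 (ε)); the ORDINARY rows (A10's T-EISRG3C cells through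
hA / the `…_thmA_atThree_OPEN` twin below, D4@3, D3) engage G♭ ∧ G♯, G♯ = the Λ-adic Eichler–Shimura / structure package
for the g-side Hida family at (3, ω⁰) (for A10's Eisenstein relatives moreover at an Eisenstein maximal ideal: r2
ADDENDUM-2 (B2)) — no printed source for G♯ either; referee C ROUND 381 (θ) (cgs25 group) extends the map — «D4 = a
THIRD engagement class, ordinary-EISENSTEIN g-side» with strike test (i) «Λ-adic ES for the ω⁰-component AT AN
EISENSTEIN maximal ideal, open curve» ∧ (ii) G♭ ∧ (iii) «the l.4175–4176 Gr-side normalisation for Eisenstein g (or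
Lemma W admitted curve-side)»; A10's T-EISRG3C relatives are Eisenstein on the g-side too (E′[3] reducible; r2
ADDENDUM-2 (B2)) — their class assignment is referee C4's word in the bstw24 round; reader 1 ADDENDUM-4 §A.1/§B states
A10's row-specific STRIKE TEST first-hand: (i-Eis) the [KLZ17 Prop. 7.2.1 / Thm. 7.2.3] package for e′_ord·lim
H¹_ét(Y₁(N·3^r), ℤ₃(1)) (OPEN curve, trivial tame component) WITHOUT a non-Eisenstein / Gorenstein / p-distinguished
hypothesis on 𝔪, ∧ (ii) G♭, ∧ [KLZ] §§8–10 at 3 on those modules, PLUS the printed-unproved Gr-side sentence l.4175–4176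
(«The restriction to D(T⁺) is mapped isomorphically onto 𝒪_λ»; from the print's inputs only 𝒪 ⊆ [ω_g, D(T⁺)] ⊆
(1−α²)⁻¹𝒪; reader 2 ADDENDUM-6 eaa05811605d1147 offers a five-step derivation «D-ω» of that clause for BSTW's own
lattice from §2's inputs — q-expansion primitivity of ω_g, integral Poincaré duality, the ordinary splitting, the cusp
boundary lying in the V⁻ direction — for the desk's check) because EVERY A10 cell is on BSTW's (anom) branch
(l.3760–3763: E′[3] reducible and a₃ ∈ {±1, ±2} ⇒ α² ≡ 1) — on A10 that sentence sits INSIDE the p = 3 wall (O3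
unchanged, 0 move); BSTW's only p = 3 remedy, Rem. 6.1, addresses the 𝐡_v side and is printed in §6 — §5 has no sentence
on 𝐠 at 3 (ADD-4 §A.1); freshness 2026-08-26T23:05Z: [SV-S-Ohta] not public, BSTW still the v2 preprint. Statement side
(r1 O1): the printed binder and its tiers are VERBATIM / weaker than print — no binder fix. Reader 2 (INDEPENDENT;
`D-AUDIT-bstw24-r2.md` sha16 69e4de3690fd21dc FROZEN + ADDENDUM-1 850c38dd32e26b8a + ADDENDUM-2 429d6b8a4b7ba185 +
ADDENDUM-3 4e4fd1ddbfa9f33b + ADDENDUM-4 f739c7b8993da616 + ADDENDUM-5 e7ed9540d359d276 + ADDENDUM-6 eaa05811605d1147),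
verdict N2 on the K3 binders T1–T4 and these tiers: statements VERBATIM / weaker-than-print twist clause; proof side NOT
re-audited by r2 (of record = bsd-ssimc BSTW-verification-v3 2c152cd7c8940032) EXCEPT the supersingular §6.2
normalisation — ADDENDUM-4 f739c7b8993da616 re-derives, from the TeX alone (reader 1's record unopened), Thm. 6.4's
constant p/(2(p+1)λ_N(g)) off Thm. 6.8 (ii) ∧ Prop. 6.7 ∧ Thm. 6.2 at every t > 0 (both parities; γ drops out), the t =
0 indeterminacy (cross term) and its source, the two «J_g» (l.5037–5043 vs l.5141–5150; Lemma 6.6's proof l.5251–5267):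
CONCUR with r1 (G-ii) / the cell's CB10, downstream propagation left to r1 / bsd-ssimc —; r2's new g-side component G3g
(KLZ17 7.2.3 / 9.5.1–2 / 10.1.1 / 10.2.2 at 3 on the trivial tame eigenspace, tame level N) concerns the ORDINARY §5
package behind CGS25 Thm. 4.1.1 and does NOT touch Thm. 1.3's supersingular §6 (no g-side Hida family). INPUT CENSUS of
record for the Ohta package at 3 (r2 ADDENDUM-2, rows C1–C12, first-hand prime ranges): [FK] (Kyoto J. Math. 64; 2012
text §0.26 «We fix a prime number p ≥ 5. Our assumption p ≥ 5 comes from the fact that in many places in this paper, we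
use results of H. Hida and M. Ohta in which they assume p ≥ 5» [corpus:paper:url-03008c92a8a1 p0007:L17–19;
typer-verified], its Prop. 1.7.9 proof resting on «Ohta ([40])» = [Oht00] [p0023:L26–27] — first-hand closure by the
cross-family reading note `pub/bsd-litref/yz26/sheets/NOTE-yz26-r2-g3-FK-Oht00-census.md` 6c6c884be7c00ca0 (context, not
a bstw24 desk object; per that note, none of 59 censused citers of [Oht00] re-proves it at 3 or on (3, ω⁰))); [Oht99] =
BSTW's [Oh1] (Compositio 115; HELD as `paper:ohta1999-ordinary-p-adic-etale-cohomology-groups-attached`, read FIRST-HAND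
by r2 ADDENDUM-5 e7ed9540d359d276: Abstract p. 241 «Fix a prime number p ≥ 5 … e*′ … the ω^i-eigenspaces of the ordinary
part, for i ≢ 0, −1 mod p − 1» [p0001:L9, L29–50], Def. (4.2.2) [p0037:L12–52]) and [Oht95] (Crelle 463; bsd-eis GDZ
deposit, read first-hand ibid.: «we fix a prime number p ≥ 5» [c0053 = p. 49:L10], e′ / e*′ := projector to ⊕_{i ≢ 0,−1}
(Def. (3.1.11)), Remark (3.2.7) «the ω⁰-eigenspace … causes another trouble, due to the fact that the corresponding
factor of J_r does not have good reduction» [c0081 = p. 77:L19]) — in r2's words «[Oh1] (Compositio 115) and Ohta 1995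
(Crelle 463) treat only the ω^i-eigenspaces with i ≢ 0, −1 (mod p−1) — a set empty at p = 3 and excluding at every p
both eigenspaces §5 uses (i = 0 for 𝐚 ∋ g_α, i = −1 for 𝐡_v); the operative Ohta text for §5 is [Oh2] (Math. Ann. 318),
printed for p ≥ 5» ([Oht00] = [Oh2]: all eigenspaces per the signed zbMATH review Zbl 0967.11016; text not held,
acq-11046); [FKS14] / [WWE18] / [Laf19] p ≥ 5; Cais 2017 / 2018 reach p > 2 on the closed curve `X₁` and EXCLUDE tame
component 0 (logarithmic p-divisible groups); Wake arXiv:1303.0406 WITHDRAWN (v4, 2017); [SV-S-Ohta] and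
Caraiani–Mantovan– Newton non-public ⇒ no public un-withdrawn text proves the open-tower / Eisenstein-inclusive row at p
= 3 (2026-08-26). The A10 / hA-side twin of this prime-tier split is
`Summit.BirchSwinnertonDyer.Rank1Residual.RowC6.CastellaGrossiSkinner2025_thmA_atThree_OPEN`
(Partition/MazurMainConjectureAtThreeOPEN.lean, p461118, typer bsd-litref-cgs25-ty). Referee desks on this reading
(D-audit desk = referee C4 `pub-bsdpct-r7` since 2026-08-26T22:54Z (litref wakes MOVED r3 → r7, one family per round;
director-bsd 22:55:33Z), before that referee C `pub-bsdpct-r3` (from 19:21Z) and C2 `pub-bsdpct-r4`; wakes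
WAKE-AUDIT-LITREF-bstw24-r1-2ab68891cb7b08bc + -add1, -add2, -add3, -add4, -add5, -r2-69e4de3690fd21dc + -add1, -add2,
-add3, -add4, -add5, -add6): referee C ROUND 353 (ζ) (2026-08-26T20:27:48Z, jsw17 group) already words the COMMON node —
«the Ohta-ES@3 node … is ONE node and takes ONE word: CONFIRMED-as-flag wherever it appears — rows D2@3 (RELAY-6), D3
(YZ26@3-BF-ERL-Ohta), A10 (T-EISRG3C cells @3), D4@3 (CGS 4.1.1 ← [BST]/BSTW §5); strike condition = a REFEREED p = 3
extension of the Λ-adic ES/structure theory at the Eisenstein ideal, or an in-cell verification of [SV-S-Ohta] when it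
becomes public» — and (ε) «Road K @ p ≥ 5 PASS-in-cell at the tier of record … @ 3: GAP((3-ii)♭) both roads — CONCUR ×2,
RELAY-6 stands»; referee C4's bstw24 family round: ROUND C4-R3 (2026-08-27T00:54:31Z, referee C4 pub-bsdpct-r7; one
slot, 12 wakes: r1 2ab68891 + ADD-1…5, r2 69e4de36 + ADD-1…5; r2 ADD-6 eaa05811 to be graded as a rider): (α) statement
audits «thm13_OPEN and thm15_pPart_OPEN VERBATIM; the X7-twist and thm15-twist binders WEAKER-than-print (intro wording;
safe direction) … PASS ×2 CONCUR» — no RETURN(line) or SMUGGLED(line) ⇒ 0 binder fixes; (β) §5 @ p = 3 «GAP(line),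
VERDICT OF RECORD» (l.2915 + l.4918–4923; strike rule = G♭ ∧ G♯^{Eis} ∧ l.4175–4176 at 3; «all A10 T-EISRG3C cells STAY
LITERAL … 0 move»; «Same wall governs K3 W1 @3»); (γ) §5 @ p ≥ 5 «PASS-in-cell MODULO PUB inputs, VERDICT OF RECORD»,
riders (R-a), (R-b), l.4175–4176 on (anom); (δ) l.4175–4176 printed-unproved CONFIRMED, Lemma W admission HELD OPEN; (ε)
Q1 «INCOMPLETE AS WORDED», Prop. 4.12 holds via r1 ADD-5 Lemma S + T «VERIFIED AT THIS DESK» ⇒ «PASS-in-cell WITH READER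
REPAIR», disagreement «DISSOLVED BY CONCESSION»; (ζ) O6, O7 @ p ≥ 5 «PASS-in-cell WITH CELL REPAIRS, CONCUR ×2»; 0 cells
move; referee A: not seized of a docstring-bearing word on this paper — GAP(line) @ 3 ⇒ 0 move (A10 register:
32 T-EISRG3C keys at the lead-B count, 31 at the A fold, CONFIRMED-as-flag register-wide: referee C R353 (ζ), R361 (ε),
A R376.4); C4-R3 (θ) opens the pricing gate — the PRICING-A10-TEISRG3C record of bsd-litref-bstw24-pv goes to A, and its
eventual word rides the next substantive edit of this file (cell ruling 2026-08-26T21:02:36Z). Statements in this file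
are UNCHANGED by the litref pass (typer `bsd-litref-bstw24-ty`).

References: [BurungaleSkinnerTianWan2024] Thm. 1.3, Rem. 5.1, §3.2.3, Part II §2.3 / Thm. 2.1 (PRE; = printed
Rem. 6.1, §4.2.3, §10.3 / Thm. 10.1);
[Kobayashi2003] Conjecture (p. 2); [SkinnerUrban2014] Thm. 2 (ram); cell records REPORT-bstw-7
(40fdbe7e627732c4), bstw-MEMO-7 (1fa682b12be3a3f9), REPORT-bstw-6 (7a95ba616d84dc36), NOTE-W-ref-2.
-/

set_option autoImplicit false

noncomputable section

open scoped Classical MatrixGroups ModularForm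

open CongruenceSubgroup WeierstrassCurve NumberField Literature.NumberTheory.EllipticCurves
  Literature.NumberTheory.EllipticCurves.ModularForms
  Literature.NumberTheory.EllipticCurves.Rank1Residual
  Literature.NumberTheory.EllipticCurves.Rank1Residual.Typed

namespace Summit.BirchSwinnertonDyer.Rank1Residual.Supersingular

/-! ### The `p = 3` tier, typed -/

section ScopeThree

/-- **OPEN BINDER — the `p = 3` TIER of the cell's reading of Burungale–Skinner–Tian–Wan,
arXiv:2409.01350v2, Thm. 1.3 (= Part II Thm. 2.1, (KoMC_r)).** "Let `E/ℚ` be a semistable elliptic curve,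
and `p > 2` a supersingular prime. If `p = 3`, suppose that (h4) [`a_3 = 0`] holds. Then Kobayashi's
Conjecture (Kob) is true", RESTRICTED to `p = 3` and to the regime of the cell bsd-ssimc's p = 3 programme
(bstw-MEMO-7 1fa682b12be3a3f9, referee REPORT-bstw-7 40fdbe7e627732c4 PASS): the (ram) prime / auxiliary
imaginary quadratic field of the printed proof (II §2.3) can be taken with `3 ∤ h_L`
(`BSTWScope.HasWitness W 3`, the rider (α) of NOTE-W-ref-2 at 3). WHAT THIS TIER RESTS ON, beyond the
`p ≥ 5` chain verified in REPORT-bstw-6 (7a95ba616d84dc36): the refereed-print replacements M1–M3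
(bookkeeping-grade, unwritten) and ONE located residual without refereed print, (3-ii)♭ = Ohta's Λ-adic
Eichler–Shimura isomorphism for the full `e′H¹(Y₁(N·3^∞))` at `p = 3` (BSTW Rem. 5.1 / §3.2.3 cite the
PREPRINT [SV-S-Ohta]) — flag `BSTW13-p3-OhtaES-preprint`, RELAY-6 «p = 3 rows NOT bookable on cell
verification». Litref D-audit of record (`pub/bsd-litref`, D-AUDIT-bstw24-r1 2ab68891cb7b08bc, O5; module
docstring § «Litref D-audit»): GAP(line) at p = 3 located at the note after Thm. 4.1 (TeX l.2915; printed §4.2.3,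
p. 34 — the «§3.2.3» above) and at Rem. 6.1 (TeX l.4918–4922, p. 58 — the «Rem. 5.1» above) ⇐ [SV-S-Ohta]
(unpublished, unlocated 2026-08-26) + Cais 2018 (partial); printed Thm. 10.1 = «Part II Thm. 2.1».
Conclusion: `KobayashiMainConjecture W p ε` for every sign, on the tree's real objects.
Strictly weaker than the printed binder `BurungaleSkinnerTianWan2024_thm13_OPEN`
(`thm13_scopedAtThree_OPEN_of_thm13_OPEN`); the exact twin of `BurungaleSkinnerTianWan2024_thm13_scoped_OPEN`
(`5 ≤ p` ↦ `p = 3 ∧ a₃ = 0`). The source is an UNREFEREED PREPRINT resting at 3 on a further preprint: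
NEVER cite this `Prop` as a theorem; take it as an explicit hypothesis. Nothing asserted.
[claim: BurungaleSkinnerTianWan2024, status: under-review]
[cite: Kobayashi2003, Conjecture (Main Conjecture) (p. 2) (shape of the conclusion only; nothing asserted)] -/
def BurungaleSkinnerTianWan2024_thm13_scopedAtThree_OPEN : Prop :=
  ∀ (W : WeierstrassCurve ℚ) [W.IsElliptic] [W.IsGloballyMinimal] (p : ℕ) [Fact p.Prime],
    p = 3 → Semistable W → GoodSS W p → W.frobeniusTrace 3 = 0 → BSTWScope.HasWitness W p →
      ∀ ε : ℤˣ, KobayashiMainConjecture W p ε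

/-- The `p = 3` tier is IMPLIED by the printed binder (it only adds hypotheses: `p = 3` with `a₃ = 0`
discharges the `p = 3 → a_3 = 0` proviso and the witness is dropped) — so taking it is never stronger than
taking Thm. 1.3. [claim: BurungaleSkinnerTianWan2024, status: under-review] -/
theorem thm13_scopedAtThree_OPEN_of_thm13_OPEN (h : BurungaleSkinnerTianWan2024_thm13_OPEN) :
    BurungaleSkinnerTianWan2024_thm13_scopedAtThree_OPEN := by
  intro W _ _ p _ h3 hsst hss ha3 _ ε
  exact h W p (by omega) hsst hss (fun _ => ha3) ε

/-- On the two scoped tiers together the printed binder's class-X6 content at every odd prime is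
recovered: `p ≥ 5` from `…_scoped_OPEN`, `p = 3` from `…_scopedAtThree_OPEN` — GIVEN a scope witness.
(For the reader: the class condition `ClassX6 W p` is `GoodSS ∧ Semistable ∧ (5 ≤ p ∨ a₃ = 0)`.)
CONDITIONAL; closes nothing. [claim: BurungaleSkinnerTianWan2024, status: under-review]
[cite: Kobayashi2003, Conjecture (Main Conjecture) (p. 2)] -/
theorem X6.kobayashiMainConjecture_of_thm13_scoped_OPEN_of_scopedAtThree_OPEN
    (h5 : BurungaleSkinnerTianWan2024_thm13_scoped_OPEN)
    (h3 : BurungaleSkinnerTianWan2024_thm13_scopedAtThree_OPEN)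
    (W : WeierstrassCurve ℚ) [W.IsElliptic] [W.IsGloballyMinimal] (p : ℕ) [Fact p.Prime]
    (hp : p ≠ 2) (hX : ClassX6 W p) (hw : BSTWScope.HasWitness W p) (ε : ℤˣ) :
    KobayashiMainConjecture W p ε := by
  by_cases hp5 : 5 ≤ p
  · exact h5 W p hp5 hX.2.1 hX.1 hw ε
  · have hpP : p.Prime := Fact.out
    have hp3 : p = 3 := by
      have h2 := hpP.two_le
      interval_cases p
      · exact absurd rfl hp
      · rfl
      · exact absurd hpP (by decide)
    have ha3 : W.frobeniusTrace 3 = 0 := by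
      rcases hX.2.2 with h | h
      · omega
      · exact h
    exact h3 W p hp3 hX.2.1 hX.1 ha3 hw ε

end ScopeThree

/-! ### Class-X6 consumers at `p = 3` with a witness -/

section ConsumersThree

variable (W : WeierstrassCurve ℚ) [W.IsElliptic] [W.IsGloballyMinimal] (p : ℕ) [Fact p.Prime]

/-- **Kobayashi's main conjecture for `(E, 3, ε)` on X6 at `p = 3`, MODULO the p = 3 tier binder and a
scope witness.** `ClassX6 W 3` supplies `a₃ = 0` (its third clause; `5 ≤ 3` is false). CONDITIONAL;
closes nothing. [claim: BurungaleSkinnerTianWan2024, status: under-review]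
[cite: Kobayashi2003, Conjecture (Main Conjecture) (p. 2)] -/
theorem X6.kobayashiMainConjecture_of_thm13_scopedAtThree_OPEN
    (h : BurungaleSkinnerTianWan2024_thm13_scopedAtThree_OPEN) (h3 : p = 3) (hX : ClassX6 W p)
    (hw : BSTWScope.HasWitness W p) (ε : ℤˣ) : KobayashiMainConjecture W p ε := by
  have ha3 : W.frobeniusTrace 3 = 0 := by
    rcases hX.2.2 with h5 | h0
    · omega
    · exact h0
  exact h W p h3 hX.2.1 hX.1 ha3 hw ε

/-- **The Eisenstein half (the predicate of crux `KobayashiLowerHalfSemistable`, registered stub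
`stub_three`) on X6 at `p = 3`, MODULO the p = 3 tier binder and a scope witness**, for every sign.
CONDITIONAL; closes nothing. [claim: BurungaleSkinnerTianWan2024, status: under-review]
[cite: Kobayashi2003, Conjecture (Main Conjecture) (p. 2)] -/
theorem X6.kobayashiLowerDivisibility_of_thm13_scopedAtThree_OPEN
    (h : BurungaleSkinnerTianWan2024_thm13_scopedAtThree_OPEN) (h3 : p = 3) (hX : ClassX6 W p)
    (hw : BSTWScope.HasWitness W p) (ε : ℤˣ) : KobayashiLowerDivisibility W p ε :=
  kobayashiLowerDivisibility_of_mainConjecture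
    (X6.kobayashiMainConjecture_of_thm13_scopedAtThree_OPEN W p h h3 hX hw ε)

/-- **`BSD(E,3)` on X6 ∧ {r_an = 0} at `p = 3`, MODULO the p = 3 tier binder and a scope witness**, the
rest PUBLISHED and by name (Wuthrich Prop. 21 `hW`, Kobayashi Thm. 1.2 `h12`, B. D. Kim Cor. 3.15 `hKim`,
Pollack `hPollack`, modularity `hmod`/`hmod'`, GZK `hGZK`) through the tree's ± rank-zero road
(`X6.bsdp_of_kobayashiMainConjecture_of_analyticRank_eq_zero`, any odd `p`). The typed form of what a
booking of an A6 @ 3 cell on the BSTW road would consume (RELAY-6: not bookable on cell verification —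
the binder carries (3-ii)♭). CONDITIONAL; closes nothing. [claim: BurungaleSkinnerTianWan2024, status: under-review]
[cite: Wuthrich2014, Prop. 21 (p. 400)] [cite: Miller2011LMS, §1 and Def. 1.1] -/
theorem X6.bsdp_of_thm13_scopedAtThree_OPEN_of_analyticRank_eq_zero
    (h : BurungaleSkinnerTianWan2024_thm13_scopedAtThree_OPEN)
    (hW : Wuthrich2014.sha_dvd_analyticSha)
    (h12 : Kobayashi2003.thm12_signedSelmerDual_finite_torsion)
    (hKim : BDKim2013.cor315_signedCharValue_rankZero)
    (hPollack : ∀ {N : ℕ} [NeZero N] {f : CuspForm (Gamma0 N) 2},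
      pollack_exists_plusMinusPAdicLFunction (W := W) (f := f) (p := p))
    (hmod : nonempty_modularParametrizationData) (hmod' : hasEntireLFunction_rat)
    (hGZK : rank_eq_analyticRank_of_analyticRank_le_one)
    (h3 : p = 3) (hX : ClassX6 W p) (hw : BSTWScope.HasWitness W p) (h0 : W.analyticRank = 0) :
    BSDp W p :=
  X6.bsdp_of_kobayashiMainConjecture_of_analyticRank_eq_zero W p hW h12 hKim hPollack hmod hmod' hGZK
    (by omega) hX h0 (X6.kobayashiMainConjecture_of_thm13_scopedAtThree_OPEN W p h h3 hX hw 1)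

end ConsumersThree

end Summit.BirchSwinnertonDyer.Rank1Residual.Supersingular

end
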